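import Mathlib
import Summits.ValiantsHypothesis.ValiantsHypothesis.Theorems.NewtonUnitEquationsNewtonTauWeakAutomatonAssembly

/-!
# `NewtonUnitEquationsNewtonTauWeakAutomatonBinomialCommon` — THEOREM A in the literal shape of the open stub T2

Rung toward `stub_binomialNewtonTauCommon` (crux `NewtonTauWeak`, stmt-ValiantsHypothesis-5904), line
`binomial-normal-form`, lead c4, CARRY-AUTOMATON rung: registered stub `stub_autoBinomialCommon`.

Claim.  For every number `K` of products, every `n`, all scalars `c : Fin K → ℂ` and all coefficients
`ρ : Fin K → Fin (3n) → ℂ`, the `K`-sum of scalar multiples of products of the `3n` binomials `1 - ρ_{lj} X^{d_j}` over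
the EXPLICIT digit-hexagon exponent list `d : Fin (3n) → ℕ²`, `d (i, u) = 2^i·(1,0), 2^i·(0,1), 2^i·(1,1)` for
`u = 0, 1, 2` (flattened along `finProdFinEquiv : Fin n × Fin 3 ≃ Fin (n * 3)`), has at most
`16 · A_K ^ ⌈log₂ n⌉` Newton vertices, `A_K = 4D³ + 2D² + 2D + 2`, `D = (16K)²` — the statement of THEOREM A
(`hex_digitHexagon_quasiPoly`, file `…AutomatonAssembly.lean`) written in the literal shape
`vert (Σ_l C (c l) * Π_j (1 - C (ρ l j) * monomial (d j) 1)) ≤ …` of the line's open stub T2.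

Proof.  Pure bookkeeping: with `a l i = ρ l (i, 0)`, `b l i = ρ l (i, 1)`, `g l i = ρ l (i, 2)` (extended by `0`
above level `n`), the product over `Fin (n * 3)` is reindexed along `finProdFinEquiv` (`Equiv.prod_comp`), split as a
double product (`Fintype.prod_prod_type`), the inner product over `Fin 3` is the level-`i` factor `hexFactor`
(`Fin.prod_univ_three`; the three `if`s evaluate at `u = 0, 1, 2`), and the outer product over `Fin n` is the product
over `Finset.range n` (`Finset.prod_range`); so the sum IS `hexSum K n c a b g` and THEOREM A applies. [folklore]
-/

set_option linter.dupNamespace false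

noncomputable section

open scoped BigOperators
open MvPolynomial
open Summit.ValiantsHypothesis.ValiantsHypothesis.Theorems.NewtonTauWeak.Negative (vert)

namespace Summit.ValiantsHypothesis.ValiantsHypothesis.Theorems.NewtonTauWeakAutomaton

namespace AutoBinomialCommonAux

/-- The product of the `3n` binomials `1 - r_j X^{d_j}` over the explicit digit-hexagon exponent list
`d (i, u) = 2^i·(1,0), 2^i·(0,1), 2^i·(1,1)` (`u = 0, 1, 2`; flattened along `finProdFinEquiv`) is the
digit-hexagon product `hexProd a b g n` with `a i = r (i, 0)`, `b i = r (i, 1)`, `g i = r (i, 2)` (and `0` above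
level `n`). [folklore] -/
theorem prod_digitHexagon_eq_hexProd (n : ℕ) (r : Fin (n * 3) → ℂ) :
    ∏ j : Fin (n * 3), (1 - C (r j) * monomial
        (if ((finProdFinEquiv.symm j).2 : ℕ) = 0 then Finsupp.single 0 (2 ^ ((finProdFinEquiv.symm j).1 : ℕ))
         else if ((finProdFinEquiv.symm j).2 : ℕ) = 1 then Finsupp.single 1 (2 ^ ((finProdFinEquiv.symm j).1 : ℕ))
         else Finsupp.single 0 (2 ^ ((finProdFinEquiv.symm j).1 : ℕ)) +
           Finsupp.single 1 (2 ^ ((finProdFinEquiv.symm j).1 : ℕ))) (1 : ℂ)) =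
      hexProd (fun i => if h : i < n then r (finProdFinEquiv (⟨i, h⟩, (0 : Fin 3))) else 0)
        (fun i => if h : i < n then r (finProdFinEquiv (⟨i, h⟩, (1 : Fin 3))) else 0)
        (fun i => if h : i < n then r (finProdFinEquiv (⟨i, h⟩, (2 : Fin 3))) else 0) n := by
  unfold hexProd
  rw [Finset.prod_range, ← Equiv.prod_comp (finProdFinEquiv : Fin n × Fin 3 ≃ Fin (n * 3)),
    Fintype.prod_prod_type]
  refine Fintype.prod_congr _ _ fun i => ?_
  have h00 : ((0 : Fin 3) : ℕ) = 0 := rfl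
  have h11 : ((1 : Fin 3) : ℕ) = 1 := rfl
  have h20 : ¬ ((2 : Fin 3) : ℕ) = 0 := by decide
  have h21 : ¬ ((2 : Fin 3) : ℕ) = 1 := by decide
  simp only [Fin.prod_univ_three, Equiv.symm_apply_apply, h00, h11, one_ne_zero, h20, h21, Fin.is_lt, dif_pos,
    Fin.eta, hexFactor, if_true, if_false]

end AutoBinomialCommonAux

/-- **THEOREM A in the literal shape of the open stub T2 (`stub_autoBinomialCommon`).** For every number `K` of
products, every `n`, all scalars `c` and all coefficients `ρ : Fin K → Fin (3n) → ℂ`, the Newton polygon of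
`Σ_{l<K} c_l Π_{j<3n} (1 - ρ_{lj} X^{d_j})`, `d` the explicit digit-hexagon exponent list
`d (i, u) = 2^i·(1,0), 2^i·(0,1), 2^i·(1,1)` (`u = 0, 1, 2`, flattened along `finProdFinEquiv`), has at most
`16 · A_K ^ ⌈log₂ n⌉` vertices, `A_K = 4D³ + 2D² + 2D + 2`, `D = (16K)²` — uniformly in `K`.
Proof: the sum is `hexSum K n c a b g` for `a l i = ρ l (i,0)`, `b l i = ρ l (i,1)`, `g l i = ρ l (i,2)`
(`AutoBinomialCommonAux.prod_digitHexagon_eq_hexProd`), and `hex_digitHexagon_quasiPoly` applies. [folklore] -/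
theorem stub_autoBinomialCommon (K n : ℕ) (c : Fin K → ℂ) (ρ : Fin K → Fin (n * 3) → ℂ) :
    vert (∑ l, C (c l) * ∏ j : Fin (n * 3),
      (1 - C (ρ l j) * monomial
        (if ((finProdFinEquiv.symm j).2 : ℕ) = 0 then Finsupp.single 0 (2 ^ ((finProdFinEquiv.symm j).1 : ℕ))
         else if ((finProdFinEquiv.symm j).2 : ℕ) = 1 then Finsupp.single 1 (2 ^ ((finProdFinEquiv.symm j).1 : ℕ))
         else Finsupp.single 0 (2 ^ ((finProdFinEquiv.symm j).1 : ℕ)) +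
           Finsupp.single 1 (2 ^ ((finProdFinEquiv.symm j).1 : ℕ))) 1)) ≤
      16 * (4 * (K * 16 * (K * 16)) ^ 3 + 2 * (K * 16 * (K * 16)) ^ 2 + 2 * (K * 16 * (K * 16)) + 2) ^ Nat.clog 2 n := by
  have h := hex_digitHexagon_quasiPoly K n c
    (fun l i => if h : i < n then ρ l (finProdFinEquiv (⟨i, h⟩, (0 : Fin 3))) else 0)
    (fun l i => if h : i < n then ρ l (finProdFinEquiv (⟨i, h⟩, (1 : Fin 3))) else 0)
    (fun l i => if h : i < n then ρ l (finProdFinEquiv (⟨i, h⟩, (2 : Fin 3))) else 0)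
  unfold hexSum at h
  simp only [AutoBinomialCommonAux.prod_digitHexagon_eq_hexProd]
  exact h

end Summit.ValiantsHypothesis.ValiantsHypothesis.Theorems.NewtonTauWeakAutomaton

end
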